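/-
Origin: expansion seat `planner-pub-hodgecm-toy2-g4-0`, handover #2 2026-08-18T07:44:29Z (`HOME/pub-hodgecm-toy2-g4/lean/Toy2g4/PadH6At.lean`, md5 cf21c5be, 158 lines);
landed by the gen-7 packager in gate run 26 as `HodgeCM/Model/Toy/ToyPadH6At.lean` (import ^import Toy2g4\.ToyPadH6\b→import HodgeCM.Model.Toy.ToyPadH6 ×1).
-/
/-
Copyright: pub-hodgecm formalisation cell (harness21, 2026). New file (not vendored).
Origin: HOME/pub-hodgecm-toy2-g4/lean/Toy2g4/PadH6At.lean — session planner-pub-hodgecm-toy2-g4-0 (unit pub-hodgecm-toy2-g4,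
CONSISTENCY seat 2, part (6a)(i)+(ii), generation 4).  WIP module `Toy2g4.PadH6At`; intended final place
`HodgeCM/Model/Toy/ToyPadH6At.lean` (module `HodgeCM.Model.Toy.ToyPadH6At`).
WIP import to rewrite on landing: `import Toy2g4.ToyPadH6` ↦ `import HodgeCM.Model.Toy.ToyPadH6` (this seat).
-/
import Summits.HodgeConjecture.HodgeCM.Model.Toy.ToyPadH6

/-!
# Pohlmann's span inclusion fails in `U♯` UNIFORMLY: at every CM field and every sextuple of CM types

`HodgeCM.Model.PadH6` / `HodgeCM.Model.Toy.ToyPadH6` exhibit the failure of `PohlmannSpan` in the padded universe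
at ONE test datum (`F = ℚ(ζ₇)`, `Θ` constant).  Part (6a)(i) of the cell's charge asks that consistency / independence
"does not rest on one example (different CM field / signature)".  This file makes the separation UNIFORM:

* `Universe.PohlmannSpanAt U F n Θ p` — the instance of Pohlmann's span inclusion at one datum `(F, n, Θ, p)`
  (`pohlmannSpan_iff : U.PohlmannSpan ↔ ∀ F, Galois → 6 ≤ [F:ℚ] → ∀ n Θ p, U.PohlmannSpanAt F n Θ p`, `Iff.rfl`);
* `not_isHodgeWeight_singletons` — for ANY CM types `Θ₀, …, Θₙ` and embeddings `φ_j ∈ Θ_j`, the weight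
  `({φ₀}, …, {φₙ})` is not a Hodge weight of any `p ≠ n + 1` (at the identity Galois translate its type is `(n+1, 0)`);
* **`PadH6.not_pohlmannSpanAt (M : U.ModelAxioms) (hN1 : U.Fact_cupExterior) (F : CMField)
  (Θ : Fin (5 + 1) → CMType F) : ¬ U.padH6.PohlmannSpanAt F 5 Θ 3`** — for EVERY CM field `F` (no Galois or degree
  hypothesis needed for the failure) and EVERY sextuple of CM types ("signatures") `Θ`, the span inclusion fails on
  `A′ = ∏_{j<6} A_{(F,Θ_j)}` in degree `6`;
* `Toy.not_padModel_pohlmannSpanAt` — the unconditional instance in `padModel`, and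
  `Toy.padModel_pohlmannSpanAt_iff_false`.

Nothing is cited; Lean + Mathlib axioms only.
-/

noncomputable section

namespace HodgeCM

open Literature.AlgebraicGeometry.Motives (CMType HodgeStructure)
open Literature.AlgebraicGeometry.Motives.HodgeStructure (ofRat)
open NumberField NumberField.ComplexEmbedding

/-- Every CM type contains an embedding (given any embedding `φ`: itself or its conjugate). -/
theorem CMTypeOps.exists_mem {K : Type} [Field K] (Φ : CMType K) (φ : K →+* ℂ) : ∃ ψ : K →+* ℂ, ψ ∈ Φ.1 := by
  by_cases h : φ ∈ Φ.1
  · exact ⟨φ, h⟩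
  · exact ⟨conjugate φ, (CMTypeOps.conjugate_mem_iff_notMem Φ φ).mpr h⟩

/-- For CM types `Θ_j` and embeddings `φ_j ∈ Θ_j`, the all-singleton weight `({φ_j})_j` has type `(n+1, 0)` at the
identity translate, so it is a Hodge weight of NO `p ≠ n + 1`. -/
theorem not_isHodgeWeight_singletons {F : Type} [Field F] [NumberField F] {n : ℕ} (Θ : Fin (n + 1) → CMType F)
    (φ : Fin (n + 1) → (F →+* ℂ)) (hφ : ∀ j, φ j ∈ (Θ j).1) {p : ℕ} (hp : p ≠ n + 1) :
    ¬ IsHodgeWeight Θ p (fun j => ({φ j} : Finset (F →+* ℂ))) := by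
  rintro ⟨-, h⟩
  have h1 := h 1
  have hind : ∀ j, ind (Θ j) ((1 : GalT F).1 (φ j)) = 1 := fun j => by
    rw [GalT.one_apply, ind, if_pos (hφ j)]
  simp only [Finset.sum_singleton, hind, Finset.sum_const, Finset.card_univ, Fintype.card_fin, nsmul_eq_mul,
    mul_one] at h1
  push_cast at h1
  omega

namespace Universe

variable (U : Universe)

/-- **Pohlmann's span inclusion at one datum** `(F, n, Θ, p)`: the complexified rational Hodge classes of
`A′ = ∏_j A_{(F,Θ_j)}` in degree `2p` lie in the span of the weight vectors of Hodge weights. -/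
def PohlmannSpanAt (F : CMField) (n : ℕ) (Θ : Fin (n + 1) → CMType F) (p : ℕ) : Prop :=
  (U.hodgeClassesOf (U.cmProd F Θ) p).map ofRat ≤
    (Submodule.span ℂ {x : U.CohC (U.cmProd F Θ) (2 * p) |
        ∃ S : Fin (n + 1) → Finset ((F : Type) →+* ℂ),
          IsHodgeWeight Θ p S ∧ U.IsWeightVector F Θ S (2 * p) x}).restrictScalars ℚ

/-- (Ported verbatim from the HodgeCMPerL package; no docstring in the source.) -/
theorem pohlmannSpan_iff :
    U.PohlmannSpan ↔ ∀ F : CMField, IsGalois ℚ F → 6 ≤ Module.finrank ℚ F →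
      ∀ (n : ℕ) (Θ : Fin (n + 1) → CMType F) (p : ℕ), U.PohlmannSpanAt F n Θ p :=
  Iff.rfl

namespace PadH6

variable {U}

set_option smartUnfolding false in
/-- **Pohlmann's span inclusion fails in `U♯` at EVERY CM field `F` and EVERY sextuple of CM types `Θ`**, on
`A′ = ∏_{j<6} A_{(F,Θ_j)}` in degree `6` (`p = 3`).  [Pick `φ_j ∈ Θ_j`; the weight `S₀ = ({φ_j})_j` is not Hodge
(`not_isHodgeWeight_singletons`) and its weight space is a LINE (`finrank_weightSpace`, from `ModelAxioms` + N1);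
the pad vectors `(0, v)` are rational Hodge classes of `H♯⁶(A′)` whose pad components exhaust `1 ⊗ H⁶(A′, ℚ)`, and
the pad component of a weight vector of `U♯` is a weight vector of `U` of the same weight; so the span inclusion
would put all of `H⁶(A′, ℂ)` inside `Σ_{S Hodge} V_S`, which is disjoint from the line `V_{S₀}`
(`iSupIndep_weightSpace`).] -/
theorem not_pohlmannSpanAt (M : U.ModelAxioms) (hN1 : U.Fact_cupExterior) (F : CMField)
    (Θ : Fin (5 + 1) → CMType F) : ¬ U.padH6.PohlmannSpanAt F 5 Θ 3 := by
  intro hP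
  -- embeddings `φ_j ∈ Θ_j`
  have hne : Nonempty ((F : Type) →+* ℂ) :=
    Fintype.card_pos_iff.mp (by rw [NumberField.Embeddings.card]; exact Module.finrank_pos)
  obtain ⟨ψ⟩ := hne
  choose φ hφ using fun j => CMTypeOps.exists_mem (Θ j) ψ
  let S₀ : Fin (5 + 1) → Finset ((F : Type) →+* ℂ) := fun j => {φ j}
  have hS₀ : ¬ IsHodgeWeight Θ 3 S₀ := not_isHodgeWeight_singletons Θ φ hφ (by norm_num)
  -- the weight space of `S₀` in degree six is a line
  have hline : Module.finrank ℂ (U.weightSpace F Θ S₀ 6) = 1 := by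
    rw [finrank_weightSpace M hN1 (by norm_num) S₀, if_pos]
    simp [S₀]
  -- `W = Σ_{S Hodge} V_S` misses it
  let W : Submodule ℂ (U.CohC (U.cmProd F Θ) 6) := ⨆ (S) (_ : IsHodgeWeight Θ 3 S), U.weightSpace F Θ S 6
  have hdisj : Disjoint (U.weightSpace F Θ S₀ 6) W :=
    (iSupIndep_weightSpace M 6 S₀).mono_right
      (iSup₂_le fun S hS => le_iSup₂_of_le S (fun hSS : S = S₀ => hS₀ (hSS ▸ hS)) le_rfl)
  -- the pad projection maps the Hodge weight vectors of `U♯` into `W`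
  let π : U.padH6.CohC (U.padH6.cmProd F Θ) (2 * 3) →ₗ[ℂ] U.CohC (U.cmProd F Θ) 6 :=
    padOfC (U := U) (U.cmProd F Θ) 6
  have hT : {x : U.padH6.CohC (U.padH6.cmProd F Θ) (2 * 3) |
      ∃ S : Fin (5 + 1) → Finset ((F : Type) →+* ℂ), IsHodgeWeight Θ 3 S ∧ U.padH6.IsWeightVector F Θ S (2 * 3) x} ⊆
      (W.comap π : Submodule ℂ _) := by
    rintro x ⟨S, hS, hx⟩
    exact Submodule.mem_iSup_of_mem S (Submodule.mem_iSup_of_mem hS (isWeightVector_padOfC Θ hx))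
  -- so every `1 ⊗ v`, `v ∈ H⁶(A′, ℚ)`, lies in `W`
  have hall : ∀ v : U.Coh (U.cmProd F Θ) 6, (ofRat v : U.CohC (U.cmProd F Θ) 6) ∈ W := by
    intro v
    have hv := hP ⟨ofPad (U := U) (U.cmProd F Θ) 6 v, ofPad_mem_hodgeClassesOf (U := U) _ v, rfl⟩
    have hW := Submodule.mem_comap.mp (Submodule.span_le.mpr hT hv)
    have hπ : π (ofRat (ofPad (U := U) (U.cmProd F Θ) 6 v)) = ofRat v := padOfC_ofRat (U := U) _ 6 _
    rwa [hπ] at hW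
  have htop : W = ⊤ := PadSix.eq_top_of_forall_ofRat_mem hall
  have hbot : U.weightSpace F Θ S₀ 6 = ⊥ := disjoint_top.mp (htop ▸ hdisj)
  rw [hbot, finrank_bot] at hline
  exact zero_ne_one hline

/-- `not_pohlmannSpan` again, now visibly independent of the test datum. -/
theorem not_pohlmannSpan' (M : U.ModelAxioms) (hN1 : U.Fact_cupExterior) : ¬ U.padH6.PohlmannSpan := fun hP => by
  obtain ⟨F, hG, h6, f, -, -⟩ := faceHypothesesInhabited
  exact not_pohlmannSpanAt M hN1 F (fun _ => f.Φ) (hP F hG h6 5 _ 3)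

end PadH6

end Universe

namespace Toy

open Universe

/-- **In `padModel`, Pohlmann's span inclusion fails at EVERY CM field `F` and EVERY sextuple of CM types** — the
separating phenomenon for the open input `pohlmann_span` does not rest on one CM field or one signature. -/
theorem not_padModel_pohlmannSpanAt (F : CMField) (Θ : Fin (5 + 1) → CMType F) : ¬ padModel.PohlmannSpanAt F 5 Θ 3 :=
  PadH6.not_pohlmannSpanAt toyModel_modelAxioms toyModel_fact_cupExterior F Θ

/-- (Ported verbatim from the HodgeCMPerL package; no docstring in the source.) -/
theorem padModel_pohlmannSpanAt_iff_false (F : CMField) (Θ : Fin (5 + 1) → CMType F) :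
    padModel.PohlmannSpanAt F 5 Θ 3 ↔ False :=
  iff_false_intro (not_padModel_pohlmannSpanAt F Θ)

/-- … while in `toyModel` it holds at every datum in Pohlmann's range. -/
theorem toyModel_pohlmannSpanAt (F : CMField) (hG : IsGalois ℚ F) (h6 : 6 ≤ Module.finrank ℚ F) (n : ℕ)
    (Θ : Fin (n + 1) → CMType F) (p : ℕ) : toyModel.PohlmannSpanAt F n Θ p :=
  toyModel_pohlmannSpan' F hG h6 n Θ p

end Toy

end HodgeCM

end
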